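import Literature.NumberTheory.ComplexMultiplication.CMTypeRankPairFlipStabilizers
import Literature.AlgebraicGeometry.Pohlmann1968.SeparatingCMFamilies
import Literature.AlgebraicGeometry.ComplexMultiplication.SexticCMFieldPairFlip
import HarnessLib

/-!
# Reflex rigidity for sextic CM fields with pair flips: two CM types with the same `Aut(ℂ)`-stabiliser (the same reflex
# field inside `ℂ`) are equivalent along a field isomorphism, and their abelian threefolds are isogenous

COR-CM (cell `pub-hodgecm2`, binder seat `b16` gen 41, count-neutral claim CM33-PAIRFLIP, file F7; theorems only, no
definition, no named fact).  NEW as stated, hence under `Summits/`.  The CM-field reading of the abstract theorem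
`Literature.NumberTheory.ComplexMultiplication.exists_equivariant_equiv_of_stabilizer_iff`
(`CMTypeRankPairFlipStabilizers`): for two sextic CM fields `K₀`, `K₁` with PAIR FLIPS (Galois closures of degree `24`
or `48`; `K₀`, `K₁` equal, isomorphic or not) and CM types `Φ₀`, `Φ₁` whose stabilisers in `Aut(ℂ)` coincide —
`σΦ₀ = Φ₀ ⟺ σΦ₁ = Φ₁`, i.e. `Aut(ℂ/K₀*) = Aut(ℂ/K₁*)`: THE TWO REFLEX FIELDS COINCIDE AS SUBFIELDS OF `ℂ` —

* `exists_equivariant_equiv_of_stabilizer_iff_of_pairFlip` — an `Aut(ℂ)`-equivariant bijection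
  `Hom(K₀, ℂ) ≃ Hom(K₁, ℂ)` carrying `Φ₀` onto `Φ₁`;
* **`exists_ringEquiv_of_stabilizer_iff_of_pairFlip`** — a field isomorphism `e : K₀ ≃ K₁` with `Φ₁ = Φ₀ ∘ e⁻¹`
  (pair-flip types are primitive; Shimura's Prop. 26 in the separation form of `Pohlmann1968/SeparatingCMFamilies`);
* **`isIsogenous_of_stabilizer_iff_of_pairFlip`** — any two CM abelian threefolds realising `(K₀, Φ₀)` and `(K₁, Φ₁)`
  are ISOGENOUS (Shimura–Taniyama); `…_of_finrank_normalClosure` by name for closures of degree `24`/`48`.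

So for this class of CM fields the reflex field ALONE (not the reflex type) determines the CM abelian threefold up to
isogeny.  This fails without pair flips (e.g. the four CM points of a cyclic sextic field all have reflex field `K`;
types of one non-Galois quartic field and of its reflex partner).  Theorems only; no `sorry`.

## References

* [Shimura1998] G. Shimura, *Abelian Varieties with Complex Multiplication and Modular Functions*, §8.2 Prop. 26,
  §8.3, §6.1 Corollary of Theorem 2.
* [Dodson1984] B. Dodson, *The structure of Galois groups of CM-fields*, Trans. AMS 283 (1984), §5.1.2.

Provenance: Literature home (namespace `Literature.AlgebraicGeometry.ComplexMultiplication.GenericSexticReflexRigidity`) of the Summits-side `CorCM/GenericSexticReflexRigidity` (cell `pub-hodgecm2`, COR-CM; all its imports are `Literature/`, Mathlib and the already re-homed `SexticCMFieldPairFlip`), which `Literature/` may not import; theorems only, no named fact, no definition. Nothing here bears on `HC_CM`. Lane `lit-hodgefound` (Layer A3: CM types, their Kubota ranks and Galois combinatorics), seat p20.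
-/

noncomputable section

open _root_.CategoryTheory NumberField Module

namespace Literature.AlgebraicGeometry.ComplexMultiplication.GenericSexticReflexRigidity

open Literature.AlgebraicGeometry.ComplexMultiplication.GenericCMField

open Literature.NumberTheory.ComplexMultiplication
open Literature.AlgebraicGeometry.Motives (AbelianVariety CMType)
open Literature.AlgebraicGeometry.HodgeTheory (complexBetti)
open Literature.AlgebraicGeometry.ComplexMultiplication (IsCMTypeRealisation)
open Literature.AlgebraicGeometry.Pohlmann1968

variable {K₀ K₁ : Type} [Field K₀] [NumberField K₀] [IsCMField K₀] [Field K₁] [NumberField K₁] [IsCMField K₁]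

/-- **Equal stabilisers of two types of pair-flip sextic CM fields give an `Aut(ℂ)`-equivariant bijection of the
embeddings carrying one type onto the other.** [cite: Dodson1984, §5.1.2 Theorem] [cite: Shimura1998, §8.3] -/
theorem exists_equivariant_equiv_of_stabilizer_iff_of_pairFlip
    (hflip₀ : ∀ s : K₀ →+* ℂ, ∃ σ : ℂ ≃+* ℂ, σ • s = (starRingAut : ℂ ≃+* ℂ) • s ∧
      ∀ t : K₀ →+* ℂ, t ≠ s → t ≠ (starRingAut : ℂ ≃+* ℂ) • s → σ • t = t)
    (hflip₁ : ∀ s : K₁ →+* ℂ, ∃ σ : ℂ ≃+* ℂ, σ • s = (starRingAut : ℂ ≃+* ℂ) • s ∧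
      ∀ t : K₁ →+* ℂ, t ≠ s → t ≠ (starRingAut : ℂ ≃+* ℂ) • s → σ • t = t)
    (h6₀ : finrank ℚ K₀ = 6) (h6₁ : finrank ℚ K₁ = 6) (Φ₀ : CMType K₀) (Φ₁ : CMType K₁)
    (hS : ∀ σ : ℂ ≃+* ℂ, (∀ x : K₀ →+* ℂ, σ • x ∈ Φ₀.1 ↔ x ∈ Φ₀.1) ↔ ∀ y : K₁ →+* ℂ, σ • y ∈ Φ₁.1 ↔ y ∈ Φ₁.1) :
    ∃ β : (K₀ →+* ℂ) ≃ (K₁ →+* ℂ), (∀ (σ : ℂ ≃+* ℂ) (x : K₀ →+* ℂ), β (σ • x) = σ • β x) ∧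
      ∀ x : K₀ →+* ℂ, β x ∈ Φ₁.1 ↔ x ∈ Φ₀.1 := by
  classical
  haveI := isPretransitive_ringEquiv_complex (K := K₀)
  haveI := isPretransitive_ringEquiv_complex (K := K₁)
  exact exists_equivariant_equiv_of_stabilizer_iff (isCMTypeWith_conj Φ₀) (isCMTypeWith_conj Φ₁) hflip₀ hflip₁ hS
    (by rw [Embeddings.card, h6₀]) (by rw [Embeddings.card, h6₁])

/-- **Reflex rigidity: equal stabilisers ⟹ a field isomorphism `e : K₀ ≃ K₁` with `Φ₁ = {u | u ∘ e ∈ Φ₀}`** (pair-flip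
types are primitive, and embeddings with the same pattern for two primitive types differ by a field isomorphism).
[cite: Shimura1998, §8.2 Prop. 26] [cite: Dodson1984, §5.1.2 Theorem] -/
theorem exists_ringEquiv_of_stabilizer_iff_of_pairFlip
    (hflip₀ : ∀ s : K₀ →+* ℂ, ∃ σ : ℂ ≃+* ℂ, σ • s = (starRingAut : ℂ ≃+* ℂ) • s ∧
      ∀ t : K₀ →+* ℂ, t ≠ s → t ≠ (starRingAut : ℂ ≃+* ℂ) • s → σ • t = t)
    (hflip₁ : ∀ s : K₁ →+* ℂ, ∃ σ : ℂ ≃+* ℂ, σ • s = (starRingAut : ℂ ≃+* ℂ) • s ∧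
      ∀ t : K₁ →+* ℂ, t ≠ s → t ≠ (starRingAut : ℂ ≃+* ℂ) • s → σ • t = t)
    (h6₀ : finrank ℚ K₀ = 6) (h6₁ : finrank ℚ K₁ = 6) (Φ₀ : CMType K₀) (Φ₁ : CMType K₁)
    (hS : ∀ σ : ℂ ≃+* ℂ, (∀ x : K₀ →+* ℂ, σ • x ∈ Φ₀.1 ↔ x ∈ Φ₀.1) ↔ ∀ y : K₁ →+* ℂ, σ • y ∈ Φ₁.1 ↔ y ∈ Φ₁.1) :
    ∃ e : K₀ ≃+* K₁, ∀ u : K₁ →+* ℂ, u ∈ Φ₁.1 ↔ u.comp e.toRingHom ∈ Φ₀.1 := by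
  obtain ⟨β, hβ, hβmem⟩ := exists_equivariant_equiv_of_stabilizer_iff_of_pairFlip hflip₀ hflip₁ h6₀ h6₁ Φ₀ Φ₁ hS
  obtain ⟨x⟩ : Nonempty (K₀ →+* ℂ) := inferInstance
  have hsmul : ∀ {L : Type} [Field L] (τ : ℂ ≃+* ℂ) (j : L →+* ℂ), (τ : ℂ →+* ℂ).comp j = τ • j := fun τ j => by
    rw [ringEquiv_smul_def, RingEquiv.toRingHom_eq_coe]
  have hpat : ∀ τ : ℂ ≃+* ℂ, (τ : ℂ →+* ℂ).comp x ∈ Φ₀.1 ↔ (τ : ℂ →+* ℂ).comp (β x) ∈ Φ₁.1 := fun τ => by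
    rw [hsmul, hsmul, ← hβ, hβmem]
  obtain ⟨e, -, he⟩ := exists_ringEquiv_of_isPrimitive_of_forall_comp_mem_iff
    (GenericCMField.isPrimitive_of_pairFlip hflip₀ Φ₀ x) (GenericCMField.isPrimitive_of_pairFlip hflip₁ Φ₁ (β x)) hpat
  exact ⟨e, he⟩

variable {A₀ A₁ : AbelianVariety ℂ} {ι₀ : 𝓞 K₀ →+* End A₀} {θ₀ : K₀ →+* Module.End ℂ (complexBetti A₀.X 1)}
  {ι₁ : 𝓞 K₁ →+* End A₁} {θ₁ : K₁ →+* Module.End ℂ (complexBetti A₁.X 1)}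

/-- **Reflex rigidity on abelian varieties: CM abelian threefolds with pair-flip sextic CM fields whose types have the
same stabiliser (the same reflex field inside `ℂ`) are ISOGENOUS.** [cite: Shimura1998, §6.1 Corollary of Theorem 2]
[cite: Dodson1984, §5.1.2 Theorem] -/
theorem isIsogenous_of_stabilizer_iff_of_pairFlip
    (hflip₀ : ∀ s : K₀ →+* ℂ, ∃ σ : ℂ ≃+* ℂ, σ • s = (starRingAut : ℂ ≃+* ℂ) • s ∧
      ∀ t : K₀ →+* ℂ, t ≠ s → t ≠ (starRingAut : ℂ ≃+* ℂ) • s → σ • t = t)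
    (hflip₁ : ∀ s : K₁ →+* ℂ, ∃ σ : ℂ ≃+* ℂ, σ • s = (starRingAut : ℂ ≃+* ℂ) • s ∧
      ∀ t : K₁ →+* ℂ, t ≠ s → t ≠ (starRingAut : ℂ ≃+* ℂ) • s → σ • t = t)
    (h6₀ : finrank ℚ K₀ = 6) (h6₁ : finrank ℚ K₁ = 6) {Φ₀ : CMType K₀} {Φ₁ : CMType K₁}
    (hS : ∀ σ : ℂ ≃+* ℂ, (∀ x : K₀ →+* ℂ, σ • x ∈ Φ₀.1 ↔ x ∈ Φ₀.1) ↔ ∀ y : K₁ →+* ℂ, σ • y ∈ Φ₁.1 ↔ y ∈ Φ₁.1)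
    (hA₀ : IsCMTypeRealisation Φ₀ A₀ ι₀ θ₀) (hA₁ : IsCMTypeRealisation Φ₁ A₁ ι₁ θ₁) :
    AbelianVariety.IsIsogenous A₀ A₁ := by
  obtain ⟨e, he⟩ := exists_ringEquiv_of_stabilizer_iff_of_pairFlip hflip₀ hflip₁ h6₀ h6₁ Φ₀ Φ₁ hS
  exact isIsogenous_of_forall_mem_iff_comp e he hA₀ hA₁

/-- **Reflex rigidity, by name for sextic CM fields whose Galois closures have degree `24` or `48`**: CM abelian
threefolds with such fields and with the same type stabiliser are isogenous (and the fields are isomorphic).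
[cite: Shimura1998, §6.1 Corollary of Theorem 2] [cite: Dodson1984, §5.1.2 Theorem] -/
theorem isIsogenous_of_stabilizer_iff_of_finrank_normalClosure (h6₀ : finrank ℚ K₀ = 6) (h6₁ : finrank ℚ K₁ = 6)
    (L₀ L₁ : Type) [Field L₀] [NumberField L₀] [IsNormalClosure ℚ K₀ L₀] [Field L₁] [NumberField L₁]
    [IsNormalClosure ℚ K₁ L₁] (hL₀ : finrank ℚ L₀ = 24 ∨ finrank ℚ L₀ = 48)
    (hL₁ : finrank ℚ L₁ = 24 ∨ finrank ℚ L₁ = 48) {Φ₀ : CMType K₀} {Φ₁ : CMType K₁}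
    (hS : ∀ σ : ℂ ≃+* ℂ, (∀ x : K₀ →+* ℂ, σ • x ∈ Φ₀.1 ↔ x ∈ Φ₀.1) ↔ ∀ y : K₁ →+* ℂ, σ • y ∈ Φ₁.1 ↔ y ∈ Φ₁.1)
    (hA₀ : IsCMTypeRealisation Φ₀ A₀ ι₀ θ₀) (hA₁ : IsCMTypeRealisation Φ₁ A₁ ι₁ θ₁) :
    AbelianVariety.IsIsogenous A₀ A₁ :=
  isIsogenous_of_stabilizer_iff_of_pairFlip (GenericCMField.pairFlip_of_finrank_normalClosure h6₀ L₀ hL₀)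
    (GenericCMField.pairFlip_of_finrank_normalClosure h6₁ L₁ hL₁) h6₀ h6₁ hS hA₀ hA₁

/-- **The contrapositive used for Hodge classes**: two NON-ISOGENOUS CM abelian threefolds with pair-flip sextic CM fields
have types with DIFFERENT stabilisers — some automorphism of `ℂ` stabilises one type and moves the other (whence
stabiliser separation and `Hg(A₀ × A₁) = Hg(A₀) × Hg(A₁)`, `CorCM/GenericSexticThreefoldPairsHodge`).
[cite: Dodson1984, §5.1.2 Theorem] [cite: Shimura1998, §8.3] -/
theorem exists_stabilizes_xor_of_not_isIsogenous_of_pairFlip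
    (hflip₀ : ∀ s : K₀ →+* ℂ, ∃ σ : ℂ ≃+* ℂ, σ • s = (starRingAut : ℂ ≃+* ℂ) • s ∧
      ∀ t : K₀ →+* ℂ, t ≠ s → t ≠ (starRingAut : ℂ ≃+* ℂ) • s → σ • t = t)
    (hflip₁ : ∀ s : K₁ →+* ℂ, ∃ σ : ℂ ≃+* ℂ, σ • s = (starRingAut : ℂ ≃+* ℂ) • s ∧
      ∀ t : K₁ →+* ℂ, t ≠ s → t ≠ (starRingAut : ℂ ≃+* ℂ) • s → σ • t = t)
    (h6₀ : finrank ℚ K₀ = 6) (h6₁ : finrank ℚ K₁ = 6) {Φ₀ : CMType K₀} {Φ₁ : CMType K₁}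
    (hA₀ : IsCMTypeRealisation Φ₀ A₀ ι₀ θ₀) (hA₁ : IsCMTypeRealisation Φ₁ A₁ ι₁ θ₁)
    (hniso : ¬AbelianVariety.IsIsogenous A₀ A₁) :
    ∃ σ : ℂ ≃+* ℂ, ¬((∀ x : K₀ →+* ℂ, σ • x ∈ Φ₀.1 ↔ x ∈ Φ₀.1) ↔ ∀ y : K₁ →+* ℂ, σ • y ∈ Φ₁.1 ↔ y ∈ Φ₁.1) := by
  by_contra hc
  push Not at hc
  exact hniso (isIsogenous_of_stabilizer_iff_of_pairFlip hflip₀ hflip₁ h6₀ h6₁ hc hA₀ hA₁)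

end Literature.AlgebraicGeometry.ComplexMultiplication.GenericSexticReflexRigidity

end
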